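import Summits.NavierStokesRegularity.FluidComputer.BlockVarCircuit

/-!
# Block line — the variable-tolerance reach circuit: bootstrap, realisation, cascade, `¬ (Clay A)`

HONEST FRAMING: low prior, high value-of-information experiment on Tao's machine paradigm; NOT a
claim that NS blows up. No `VarReachCircuit` is known to exist for the Navier–Stokes equations;
every theorem below is an implication from such a (so far uninhabited) structure, by the proofs of
the blueprint's reach layer (`Literature/…/FluidComputer/ReachCircuit.lean` §§5–7,
[cite: Tao2016AveragedNS, §1.3 pp. 10–11]), generation index and defect modulus threaded in.

WHAT IS PROVED ([folklore] unless cited). §5 the BOOTSTRAP `reach_sharp` (along every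
`H¹⁰_df`-mild Navier–Stokes trajectory loaded at generation `n`, for every rescaled `σ ≤ τc` inside
the lifespan the readout is in `Tube n (read n (u t)) σ` and the junk is `≤ (jin + γσ) √E_n`;
continuous induction on physical time), `leak`, `guard_of_loaded`, and REALISATION `fires`. §6 the
pump cascade `toPumpCascade` of the design and `ns_blowup`: a variable-tolerance reach design with
`α > 0`, `η > 1/4` refutes `NavierStokesRegularity` (`ns_blowup_of_pumpCascade`). §7 LIVENESS from
PER-INPUT `H¹⁰` control of the tube (`ControlAt`: one bound per input readout, the form open
windows need, cf. `BlockOpenLive`) and the CASCADE THEOREM `energy_reaches_all_scales_of_controlAt`.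
§8 CONSERVATIVITY: every blueprint `ReachCircuit` is a `VarReachCircuit` with constant modulus and
level-free data (`ofReachCircuit`), with the same classes, gadgets and pump cascade (`rfl`).
RESTAGED (gen 38) with explicit `(R : VarReachCircuit S O s)` binders, as `BlockVarCircuit.lean`.
-/

noncomputable section

open MeasureTheory Set Filter Topology
open scoped ENNReal NNReal SchwartzMap

namespace Summit.NavierStokesRegularity.FluidComputer

open Literature.Analysis.FluidPDE Literature.Analysis.FluidPDE.Tao2016
open Literature.Analysis.FluidPDE.FluidComputer
open Literature.Analysis.FunctionSpaces (eFourierSobolevNorm)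
open Summit.NavierStokesRegularity.NavierStokesRegularity.Theorems.FluidComputer

namespace VarReachCircuit

variable {S : CascadeSpecs} {O : Type*} [NormedAddCommGroup O] [NormedSpace ℝ O] {s : ℝ}

/-! ### §5. The bootstrap: reach tube and leakage over a whole cycle -/

/-- **SHARP REACH AND LEAKAGE over a whole cycle** (the bootstrap). Along every `H¹⁰_df`-mild
Navier–Stokes trajectory LOADED at generation `n` at time `t ≥ 0` (`read n (u t) ∈ Ain n`,
`junk n (u t) ≤ jin √E_n`), for every rescaled `σ ∈ [0, τc]` with `t + unit n · σ` inside the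
lifespan: the readout is in `Tube n (read n (u t)) σ` AND the junk is at most `(jin + γ σ) √E_n`.
Continuous induction on physical time for the set where both hold: closed (`Tube_closed`,
continuity along the trajectory), true at `t` (`Tube_zero`), and propagating past any `x` (both
conditions put the state in the open working region on `[t, x]`, hence a little longer, where
`cert_of_guard` / `junk_toReal_le_of_guard` re-establish both). [folklore] -/
theorem reach_sharp (R : VarReachCircuit S O s) (n : ℕ) (a : L2C) (S' : ℝ) (u : ℝ → L2C)
    (hu : IsMildSolutionFor eulerForm a (Ico 0 S') u) (t : ℝ) (ht : 0 ≤ t)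
    (hin : R.read n (u t) ∈ R.Ain n)
    (hj : R.junk n (u t) ≤ ENNReal.ofReal (R.jin * Real.sqrt (S.Emin n)))
    (σ : ℝ) (hσ0 : 0 ≤ σ) (hστ : σ ≤ R.τc) (hlt : t + R.unit n * σ < S') :
    R.read n (u (t + R.unit n * σ)) ∈ R.Tube n (R.read n (u t)) σ ∧
      R.junk n (u (t + R.unit n * σ)) ≤
        ENNReal.ofReal ((R.jin + R.γ * σ) * Real.sqrt (S.Emin n)) := by
  have hun := R.unit_pos n
  have hE : 0 < Real.sqrt (S.Emin n) := Real.sqrt_pos.2 (S.Emin_pos n)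
  set p : O := R.read n (u t) with hp
  set T₁ : ℝ := t + R.unit n * σ with hT₁
  have htT₁ : t ≤ T₁ := le_add_of_nonneg_right (mul_nonneg hun.le hσ0)
  have hI : Icc t T₁ ⊆ Ico 0 S' := fun y hy => ⟨ht.trans hy.1, hy.2.trans_lt hlt⟩
  have htI : t ∈ Ico 0 S' := hI ⟨le_rfl, htT₁⟩
  -- rescaled time elapsed since `t`
  set τ : ℝ → ℝ := fun x => (x - t) / R.unit n with hτ
  have hτx : ∀ x, t + R.unit n * τ x = x := fun x => by
    simp only [hτ]; rw [mul_comm, div_mul_cancel₀ _ hun.ne']; ring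
  have hτt : τ t = 0 := by simp [hτ]
  have hτT₁ : τ T₁ = σ := by
    simp only [hτ, hT₁, add_sub_cancel_left, mul_div_cancel_left₀ σ hun.ne']
  have hτ_mono : ∀ x y, x ≤ y → τ x ≤ τ y := fun x y hxy =>
    div_le_div_of_nonneg_right (sub_le_sub_right hxy t) hun.le
  have hτ_le : ∀ x ∈ Icc t T₁, τ x ∈ Icc 0 R.τc := fun x hx =>
    ⟨div_nonneg (sub_nonneg.2 hx.1) hun.le, ((hτ_mono x T₁ hx.2).trans_eq hτT₁).trans hστ⟩
  have hτc : Continuous τ := by simp only [hτ]; fun_prop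
  -- junk is finite along the trajectory; its real value
  have hfin : ∀ x ∈ Ico 0 S', R.junk n (u x) ≠ ⊤ := fun x hx =>
    R.junk_ne_top hu n htI (ne_top_of_le_ne_top ENNReal.ofReal_ne_top hj) hx
  set J : ℝ → ℝ := fun x => (R.junk n (u x)).toReal with hJ
  have hJt : J t ≤ R.jin * Real.sqrt (S.Emin n) :=
    ENNReal.toReal_le_of_le_ofReal (mul_pos (R.jcore_nonneg.trans_lt R.jcore_lt) hE).le hj
  -- the bootstrap set
  set B : Set ℝ := {x | (τ x ∈ Icc 0 R.τc ∧ R.read n (u x) ∈ R.Tube n p (τ x)) ∧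
    J x ≤ R.jin * Real.sqrt (S.Emin n) + R.γ * Real.sqrt (S.Emin n) * τ x} with hB
  -- (i) members of `B` in the lifespan are in the working region
  have hguard : ∀ x ∈ Icc t T₁, x ∈ B → R.Guard n (u x) := by
    intro x hx hxB
    refine R.guard_of_mem n hin hxB.1.1 hxB.1.2 ?_
    rw [← ENNReal.ofReal_toReal (hfin x (hI hx))]
    refine ENNReal.ofReal_le_ofReal ?_
    calc J x ≤ R.jin * Real.sqrt (S.Emin n) + R.γ * Real.sqrt (S.Emin n) * τ x := hxB.2
      _ = (R.jin + R.γ * τ x) * Real.sqrt (S.Emin n) := by ring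
  -- (ii) `B ∩ [t, T₁]` is closed
  have hclosed : IsClosed (B ∩ Icc t T₁) := by
    have hread : ContinuousOn (fun x => R.read n (u x)) (Icc t T₁) :=
      (R.read_continuousOn hu n).mono hI
    have hpair : ContinuousOn (fun x => (τ x, R.read n (u x))) (Icc t T₁) :=
      hτc.continuousOn.prodMk hread
    have h1 := hpair.preimage_isClosed_of_isClosed isClosed_Icc (R.Tube_closed n p hin)
    have hJc : ContinuousOn J (Icc t T₁) := fun y hy =>
      (R.junk_toReal_continuousWithinAt hu n (hI hy) (hfin y (hI hy))).mono hI
    have hrhs : Continuous fun x =>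
        R.jin * Real.sqrt (S.Emin n) + R.γ * Real.sqrt (S.Emin n) * τ x := by
      fun_prop
    have h2 := hJc.prodMk hrhs.continuousOn |>.preimage_isClosed_of_isClosed isClosed_Icc
      isClosed_le_prod
    have hEq : B ∩ Icc t T₁ =
        (Icc t T₁ ∩ (fun x => (τ x, R.read n (u x))) ⁻¹'
            {z : ℝ × O | z.1 ∈ Icc 0 R.τc ∧ z.2 ∈ R.Tube n p z.1}) ∩
          (Icc t T₁ ∩ (fun x => (J x,
              R.jin * Real.sqrt (S.Emin n) + R.γ * Real.sqrt (S.Emin n) * τ x)) ⁻¹'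
            {q : ℝ × ℝ | q.1 ≤ q.2}) := by
      ext x
      simp only [hB, mem_inter_iff, mem_setOf_eq, mem_preimage]
      tauto
    rw [hEq]
    exact h1.inter h2
  -- (iii) `t ∈ B`
  have htB : t ∈ B := by
    refine ⟨⟨?_, ?_⟩, ?_⟩
    · rw [hτt]; exact ⟨le_rfl, R.τc_nonneg⟩
    · rw [hτt]; exact R.Tube_zero n p hin
    · rw [hτt, mul_zero, add_zero]; exact hJt
  -- (iv) continuous induction
  have hmain : Icc t T₁ ⊆ B := by
    refine hclosed.Icc_subset_of_forall_mem_nhdsGT_of_Icc_subset htB fun x hx hxB => ?_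
    have hxI : x ∈ Ico 0 S' := hI ⟨hx.1, hx.2.le⟩
    have hG1 : ∀ y ∈ Icc t x, R.Guard n (u y) := fun y hy =>
      hguard y ⟨hy.1, hy.2.trans hx.2.le⟩ (hxB hy)
    obtain ⟨m, hxm, hmT, hG2⟩ : ∃ m, x < m ∧ m ≤ T₁ ∧ ∀ y ∈ Ico x m, R.Guard n (u y) := by
      have hGx := hG1 x ⟨hx.1, le_rfl⟩
      have h1 : ∀ᶠ y in 𝓝[Ico 0 S'] x, R.read n (u y) ∈ R.U n :=
        Filter.Tendsto.eventually_mem ((R.read_continuousOn hu n) x hxI)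
          ((R.U_open n).mem_nhds hGx.1)
      have h2 : ∀ᶠ y in 𝓝[Ico 0 S'] x,
          R.junk n (u y) < ENNReal.ofReal (R.jbar * Real.sqrt (S.Emin n)) :=
        Filter.Tendsto.eventually_mem (R.junk_tendsto hu n hxI (hfin x hxI)) (Iio_mem_nhds hGx.2)
      obtain ⟨η, hη, hball⟩ :=
        Metric.eventually_nhds_iff.1 (eventually_nhdsWithin_iff.1 (h1.and h2))
      refine ⟨min (x + η) T₁, lt_min (by linarith) hx.2, min_le_right _ _, fun y hy => ?_⟩
      have hy1 : y < x + η := (lt_min_iff.1 hy.2).1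
      have hy2 : y < T₁ := (lt_min_iff.1 hy.2).2
      have hyx : dist y x < η := by
        rw [Real.dist_eq, abs_of_nonneg (sub_nonneg.2 hy.1)]; linarith
      exact hball hyx ⟨(ht.trans hx.1).trans hy.1, hy2.trans hlt⟩
    have hIoo : Ioo x m ⊆ B := by
      intro y hy
      have hyT : y ≤ T₁ := hy.2.le.trans hmT
      have hty : t ≤ y := hx.1.trans hy.1.le
      have hyS : y < S' := (hy.2.trans_le hmT).trans hlt
      have hGy : ∀ z ∈ Ico t y, R.Guard n (u z) := by
        intro z hz
        rcases le_or_gt z x with hzx | hxz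
        · exact hG1 z ⟨hz.1, hzx⟩
        · exact hG2 z ⟨hxz.le, hz.2.trans hy.2⟩
      have hτy : τ y ∈ Icc 0 R.τc := hτ_le y ⟨hty, hyT⟩
      refine ⟨⟨hτy, ?_⟩, ?_⟩
      · have hS'y : t + R.unit n * τ y < S' := by rw [hτx]; exact hyS
        have hGy' : ∀ z ∈ Ico t (t + R.unit n * τ y), R.Guard n (u z) := by rw [hτx]; exact hGy
        have h := (R.cert_of_guard hu n ht hin hτy.1 hτy.2 hS'y hGy').1
        rwa [hτx] at h
      · have h := R.junk_toReal_le_of_guard hu n ht hyS (hfin t htI) hGy y ⟨hty, le_rfl⟩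
        calc J y ≤ J t + R.γ * (Real.sqrt (S.Emin n) / R.unit n) * (y - t) := h
          _ = J t + R.γ * Real.sqrt (S.Emin n) * τ y := by simp only [hτ]; ring
          _ ≤ R.jin * Real.sqrt (S.Emin n) + R.γ * Real.sqrt (S.Emin n) * τ y :=
              add_le_add_left hJt _
    exact mem_of_superset (Ioo_mem_nhdsGT hxm) hIoo
  -- (v) read off at `T₁`
  have hT₁B := hmain ⟨htT₁, le_rfl⟩
  refine ⟨?_, ?_⟩
  · have h : R.read n (u T₁) ∈ R.Tube n p (τ T₁) := hT₁B.1.2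
    rwa [hτT₁] at h
  · rw [← ENNReal.ofReal_toReal (hfin T₁ (hI ⟨htT₁, le_rfl⟩))]
    refine ENNReal.ofReal_le_ofReal ?_
    calc J T₁ ≤ R.jin * Real.sqrt (S.Emin n) + R.γ * Real.sqrt (S.Emin n) * τ T₁ := hT₁B.2
      _ = (R.jin + R.γ * σ) * Real.sqrt (S.Emin n) := by rw [hτT₁]; ring

/-- **LEAKAGE over a whole cycle**: junk below the running threshold `jrun √E_n`, unguarded, up to
lifespan. [cite: Tao2016AveragedNS, §1.3 pp. 10–11] -/
theorem leak (R : VarReachCircuit S O s) (n : ℕ) (a : L2C) (S' : ℝ) (u : ℝ → L2C)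
    (hu : IsMildSolutionFor eulerForm a (Ico 0 S') u) (t : ℝ) (ht : 0 ≤ t)
    (hin : R.read n (u t) ∈ R.Ain n)
    (hj : R.junk n (u t) ≤ ENNReal.ofReal (R.jin * Real.sqrt (S.Emin n)))
    (σ : ℝ) (hσ0 : 0 ≤ σ) (hστ : σ ≤ R.τc) (hlt : t + R.unit n * σ < S') :
    R.junk n (u (t + R.unit n * σ)) ≤ ENNReal.ofReal (R.jrun * Real.sqrt (S.Emin n)) :=
  (R.reach_sharp n a S' u hu t ht hin hj σ hσ0 hστ hlt).2.trans (ENNReal.ofReal_le_ofReal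
    (mul_le_mul_of_nonneg_right (R.jin_add_mul_le hστ) (Real.sqrt_nonneg _)))

/-- **A loaded trajectory stays in the working region for the whole cycle** (unguarded, up to
lifespan). [folklore] -/
theorem guard_of_loaded (R : VarReachCircuit S O s) (n : ℕ) (a : L2C) (S' : ℝ) (u : ℝ → L2C)
    (hu : IsMildSolutionFor eulerForm a (Ico 0 S') u) (t : ℝ) (ht : 0 ≤ t) (hin : u t ∈ R.In n)
    {y : ℝ} (hty : t ≤ y) (hyT : y ≤ t + R.unit n * R.τc) (hyS : y < S') : R.Guard n (u y) := by
  have hun := R.unit_pos n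
  obtain ⟨σ, hσ0, hστ, rfl⟩ : ∃ σ, 0 ≤ σ ∧ σ ≤ R.τc ∧ t + R.unit n * σ = y := by
    refine ⟨(y - t) / R.unit n, div_nonneg (sub_nonneg.2 hty) hun.le, ?_, ?_⟩
    · rw [div_le_iff₀ hun]; linarith [mul_comm (R.unit n) R.τc]
    · rw [mul_div_cancel₀ _ hun.ne']; ring
  have h := R.reach_sharp n a S' u hu t ht hin.1 hin.2 σ hσ0 hστ hyS
  exact R.guard_of_mem n hin.1 ⟨hσ0, hστ⟩ h.1 h.2

/-- **REALISATION (`PumpGadget.fires`) is a theorem of the design**: every mild Navier–Stokes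
trajectory loaded at generation `n` at time `t ≥ 0` and alive past `t + unit n · τc` passes through
the generation-`n` output class within that time (`guard_of_loaded`, the REACH clause of
`cert_of_guard` with `σT = τc`, `leak`, `handoff`). Early firing is harmless. [cite: Tao2016AveragedNS, §1.3 pp. 10–11] -/
theorem fires (R : VarReachCircuit S O s) (n : ℕ) (a : L2C) (S' : ℝ) (u : ℝ → L2C)
    (hu : IsMildSolutionFor eulerForm a (Ico 0 S') u) (t : ℝ) (ht : 0 ≤ t) (hin : u t ∈ R.In n)
    (hT : t + R.unit n * R.τc < S') :
    ∃ r : ℝ, t ≤ r ∧ r ≤ t + R.unit n * R.τc ∧ u r ∈ R.Out n := by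
  have hun := R.unit_pos n
  have hG : ∀ x ∈ Ico t (t + R.unit n * R.τc), R.Guard n (u x) := fun x hx =>
    R.guard_of_loaded n a S' u hu t ht hin hx.1 hx.2.le (hx.2.trans hT)
  obtain ⟨σ, hσ, hout⟩ := (R.cert_of_guard hu n ht hin.1 R.τc_nonneg le_rfl hT hG).2 rfl
  have hle : t + R.unit n * σ ≤ t + R.unit n * R.τc := by nlinarith [hσ.2, hun.le]
  have hlt : t + R.unit n * σ < S' := hle.trans_lt hT
  have hlk := R.leak n a S' u hu t ht hin.1 hin.2 σ hσ.1 hσ.2 hlt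
  exact ⟨t + R.unit n * σ, le_add_of_nonneg_right (mul_nonneg hun.le hσ.1), hle,
    R.handoff n _ hout hlk⟩

/-! ### §6. The pump cascade of the design and `¬ (Clay A)` -/

/-- **The generation-`n` pump gadget of the design**: scale `λ_n`, classes `In n` / `Out n`, floor
`E_n` (`floor_cert`), tick `unit n · τc`, realisation by `fires`. [cite: Tao2016AveragedNS, §1.3 pp. 10–11] -/
def gadget (R : VarReachCircuit S O s) (n : ℕ) : PumpGadget where
  κ := S.lam n
  κ_nonneg := (S.lam_pos n).le
  In := R.In n
  Out := R.Out n
  Ein := S.Emin n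
  in_floor := fun v hv => R.floor_cert n v hv.1 hv.2
  T := R.unit n * R.τc
  T_nonneg := mul_nonneg (R.unit_pos n).le R.τc_nonneg
  fires := R.fires n

/-- The gadget's input class is the design's. [folklore] -/
@[simp] theorem gadget_In (R : VarReachCircuit S O s) (n : ℕ) : (R.gadget n).In = R.In n := rfl
/-- The gadget's output class is the design's. [folklore] -/
@[simp] theorem gadget_Out (R : VarReachCircuit S O s) (n : ℕ) : (R.gadget n).Out = R.Out n := rfl

/-- **The pump cascade of the design** (`PumpCascade S`): realisation, self-replication, floors,
clock and ignition are theorems of the design's fields. [cite: Tao2016AveragedNS, §1.3 pp. 10–11] -/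
def toPumpCascade (R : VarReachCircuit S O s) : PumpCascade S where
  G := R.gadget
  scale := fun _ => rfl
  replicate := R.Out_subset_In
  energy := fun _ => le_rfl
  time := R.clock
  u₀ := R.u₀
  divFree := R.divFree
  memH10df := R.memH10df
  ignite := R.seed_mem_In

/-- **Blow-up from a variable-tolerance reach design** (`α > 0`, `η > 1/4`): the existence of a
`VarReachCircuit` refutes `NavierStokesRegularity` (Clay (A)) — `ns_blowup_of_pumpCascade` applied
to the design's cascade. An implication from an uninhabited structure; NOT a claim that NS blows
up. [cite: Tao2016AveragedNS, §1.3 pp. 10–11] -/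
theorem ns_blowup (R : VarReachCircuit S O s) (hα : 0 < S.alpha) (hη : 1 / 4 < S.eta) :
    ¬ NavierStokesRegularity :=
  ns_blowup_of_pumpCascade R.toPumpCascade hα hη

/-! ### §7. Liveness from PER-INPUT `H¹⁰` control of the tube; the cascade theorem -/

/-- **Per-input `H¹⁰` control of the reach tube**: for every generation `n` and every input readout
`p ∈ Ain n` separately, one bound on the `H¹⁰` norm of the `H¹⁰_df` states read in `Tube n p σ`,
`σ ∈ [0, τc]`, with junk below the running threshold (what liveness consumes; the uniform bound
per generation fails for open windows). [folklore] -/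
def ControlAt (R : VarReachCircuit S O s) : Prop :=
  ∀ n : ℕ, ∀ p ∈ R.Ain n, ∃ M : ℝ, ∀ v : L2C, MemH10df v →
    (∃ σ ∈ Icc 0 R.τc, R.read n v ∈ R.Tube n p σ) →
      R.junk n v ≤ ENNReal.ofReal (R.jrun * Real.sqrt (S.Emin n)) →
        eFourierSobolevNorm 10 v ≤ ENNReal.ofReal M

/-- **LIVENESS from per-input control** (given the `H¹⁰` mild theory): a loaded `H¹⁰_df` state
all of whose trajectories die within the tick has a maximal trajectory with unbounded `H¹⁰` norm,
which `reach_sharp` keeps in the reach tube of its initial readout with running junk — an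
`H¹⁰`-bounded set. [cite: Tao2016AveragedNS, §6 Prop. 6.3] -/
theorem live_of_controlAt (R : VarReachCircuit S O s) (hth : H10MildTheory) (hctrl : R.ControlAt) :
    R.toPumpCascade.Live := by
  intro n v hv h10
  by_contra hne
  push Not at hne
  have hle : ∀ (S' : ℝ) (u : ℝ → L2C), IsMildSolutionFor eulerForm v (Ico 0 S') u →
      S' ≤ R.unit n * R.τc := by
    intro S' u hu
    by_contra h
    exact hne S' (lt_of_not_ge h) u hu
  have hvIn : v ∈ R.In n := hv
  obtain ⟨M, hM⟩ := hctrl n (R.read n v) hvIn.1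
  obtain ⟨Sm, hSm, hSmT, U, hU, -, hunb⟩ := exists_maximal_unbounded_of_lifespan_le hth h10 hle
  obtain ⟨t', ht', hlt⟩ := hunb M
  have h0 : U 0 = v := initial_eq hU ⟨le_rfl, hSm⟩ h10
  have hv' : U 0 ∈ R.In n := by rw [h0]; exact hv
  have hne0 : R.unit n ≠ 0 := (R.unit_pos n).ne'
  set σ : ℝ := t' / R.unit n with hσdef
  have hσ0 : 0 ≤ σ := div_nonneg ht'.1 (R.unit_pos n).le
  have hσeq : R.unit n * σ = t' := by rw [mul_comm]; exact div_mul_cancel₀ t' hne0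
  have hστ : σ ≤ R.τc := by
    have h1 : R.unit n * σ ≤ R.unit n * R.τc := by rw [hσeq]; exact ht'.2.le.trans hSmT
    exact le_of_mul_le_mul_left h1 (R.unit_pos n)
  have hlt' : 0 + R.unit n * σ < Sm := by rw [zero_add, hσeq]; exact ht'.2
  have h := R.reach_sharp n v Sm U hU 0 le_rfl hv'.1 hv'.2 σ hσ0 hστ hlt'
  rw [zero_add, hσeq, h0] at h
  have hbd := hM (U t') (hU.1 t' ht') ⟨σ, ⟨hσ0, hστ⟩, h.1⟩
    (h.2.trans (ENNReal.ofReal_le_ofReal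
      (mul_le_mul_of_nonneg_right (R.jin_add_mul_le hστ) (Real.sqrt_nonneg _))))
  exact absurd hlt (not_lt.2 hbd)

/-- **THE CASCADE THEOREM for a per-input-controlled variable-tolerance reach design** (`α > 0`,
`η > 1/4`; the mild `H¹⁰` theory is the tree's `h10MildTheory_holds`): along the seed's maximal
`H¹⁰_df`-mild trajectory every generation's floor energy `E_n` is present at frequency `≥ λ_n` at a
clocked instant `t_n ≤ ∑_{k<n} Tmax k < S_m ≤ T_*`, and the `H¹⁰` norm is unbounded on `[0, S_m)`.
[cite: Tao2016AveragedNS, §6 Prop. 6.3] -/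
theorem energy_reaches_all_scales_of_controlAt (R : VarReachCircuit S O s) (hα : 0 < S.alpha)
    (hη : 1 / 4 < S.eta) (hctrl : R.ControlAt) :
    ∃ Sm : ℝ, 0 < Sm ∧ Sm ≤ S.Tstar ∧ ∃ U : ℝ → L2C,
      IsMildSolutionFor eulerForm (schwartzL2 R.u₀) (Ico 0 Sm) U ∧
      (∀ C : ℝ, ∃ s ∈ Ico 0 Sm, ENNReal.ofReal C < eFourierSobolevNorm 10 (U s)) ∧
      ∃ t : ℕ → ℝ, t 0 = 0 ∧ Monotone t ∧
        ∀ n, t n < Sm ∧ t n ≤ ∑ k ∈ Finset.range n, S.Tmax k ∧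
          ENNReal.ofReal (S.Emin n) ≤ highFreqEnergy (S.lam n) (U (t n)) :=
  energy_reaches_all_scales R.toPumpCascade hα hη (R.live_of_controlAt h10MildTheory_holds hctrl)

/-! ### §8. Conservativity: a blueprint reach design IS a variable-tolerance one -/

/-- **Every `ReachCircuit` is a `VarReachCircuit`** with constant modulus `ω n z = ε` and
level-free regions, field, working region and tube. [folklore] -/
def ofReachCircuit (A : ReachCircuit S O s) : VarReachCircuit S O s where
  read := A.read
  recon := A.recon
  junk := A.junk
  Λ := A.Λ
  Λ_pos := A.Λ_pos
  read_lip := A.read_lip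
  junk_perturb := A.junk_perturb
  s_le_ten := A.s_le_ten
  read_recon := A.read_recon
  junk_recon := A.junk_recon
  Ain := fun _ => A.Ain
  Acore := fun _ => A.Acore
  Aout := fun _ => A.Aout
  δ := A.δ
  δ_pos := A.δ_pos
  core_thick := fun _ => A.core_thick
  jcore := A.jcore
  jin := A.jin
  jrun := A.jrun
  jbar := A.jbar
  jcore_nonneg := A.jcore_nonneg
  jcore_lt := A.jcore_lt
  jrun_lt_jbar := A.jrun_lt_jbar
  handoff := A.handoff
  floor_cert := A.floor_cert
  F := fun _ => A.F
  U := fun _ => A.U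
  U_open := fun _ => A.U_open
  τc := A.τc
  τc_nonneg := A.τc_nonneg
  ω := fun _ _ => A.ε
  Tube := fun _ => A.Tube
  Tube_closed := fun _ => A.Tube_closed
  Tube_zero := fun _ => A.Tube_zero
  Tube_sub := fun _ => A.Tube_sub
  cert := fun _ => A.cert
  γ := A.γ
  γ_nonneg := A.γ_nonneg
  jrun_ge := A.jrun_ge
  unit := A.unit
  unit_pos := A.unit_pos
  clock := A.clock
  defect := A.defect
  junk_rate := A.junk_rate
  u₀ := A.u₀
  divFree := A.divFree
  memH10df := A.memH10df
  seed_read := A.seed_read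
  seed_junk := A.seed_junk

/-- The embedding preserves the input classes. [folklore] -/
@[simp] theorem ofReachCircuit_In (A : ReachCircuit S O s) (n : ℕ) :
    (ofReachCircuit A).In n = A.In n := rfl

/-- The embedding preserves the output classes. [folklore] -/
@[simp] theorem ofReachCircuit_Out (A : ReachCircuit S O s) (n : ℕ) :
    (ofReachCircuit A).Out n = A.Out n := rfl

/-- The embedding preserves the pump gadgets. [folklore] -/
@[simp] theorem ofReachCircuit_gadget (A : ReachCircuit S O s) (n : ℕ) :
    (ofReachCircuit A).gadget n = A.gadget n := rfl

/-- The embedding preserves the pump cascade: the blueprint's reach theorems are the special case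
`ω ≡ ε` of this file's. [folklore] -/
@[simp] theorem ofReachCircuit_toPumpCascade (A : ReachCircuit S O s) :
    (ofReachCircuit A).toPumpCascade = A.toPumpCascade := rfl

end VarReachCircuit

end Summit.NavierStokesRegularity.FluidComputer
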